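import Summits.KontsevichZagierPeriods.KontsevichZagierPeriods.Theorems.HurwitzMicroSectorsNormalFormPrincipleAlgLevelOneReduction

/-!
# `NormalFormPrinciple` (stmt-KontsevichZagierPeriods-3869), line `SketchIdeator1` — leaf `stub_boxRigidity`:
# LEVEL ONE WITH REAL-ALGEBRAIC COEFFICIENTS, II: Conjecture 1 (kernel form) on the layer

On the subgroup of `FormalRep` generated by the boxes `[(0,1)², P/(1 − xy)]`, `P ∈ (ℚ̄ ∩ ℝ)[x,y]`, and
the algebraic points `[pt, r]`, `r ∈ ℚ̄ ∩ ℝ`, every element has a normal form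
`[(0,1)², β/(1−xy)] + [pt, q]` modulo `relations` with `β, q` real algebraic
(`exists_normalForm_of_mem_algClosure`, from part I); its value is `β·π²/6 + q`, and `π²/6 ∉ ℚ̄`
(Lindemann) makes `(β, q)` rigid, so value `0` forces `β = q = 0` and the element is a relation:
Conjecture 1 of Kontsevich–Zagier holds on this layer unconditionally
(`alg_mem_relations_of_eval_eq_zero_of_mem_closure`). [cite: KontsevichZagier2001, §1.2 Conjecture 1]
-/

noncomputable section

open MeasureTheory Set
open Literature.NumberTheory.Transcendental Literature.NumberTheory.Transcendental.KZ
open Literature.ModelTheory.ExponentialFields (IsSemialgebraic)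

namespace Summit.KontsevichZagierPeriods.HurwitzMicroSectors.NormalFormPrinciple.PiBox.AlgLevelOne

open Summit.KontsevichZagierPeriods.HurwitzMicroSectors.NormalFormPrinciple.PiBox.Dlog
  (pt_zero_mem_relations pt_congr_mem_relations exists_ptCarrierA)

/-! ## The layer: Conjecture 1, kernel form, for level one with real-algebraic coefficients -/

/-- **Normal forms on the subgroup** generated by the algebraic level-one boxes `[(0,1)², P/(1−xy)]`
(`P ∈ (ℚ̄ ∩ ℝ)[x,y]`) and the algebraic points `[pt, r]` (`r ∈ ℚ̄ ∩ ℝ`). [cite: KontsevichZagier2001, §1.2] -/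
theorem exists_normalForm_of_mem_algClosure {x : FormalRep}
    (hx : x ∈ AddSubgroup.closure
      ({y : FormalRep | ∃ (P : MvPolynomial (Fin 2) ℝ) (N : IntegralRep 2),
          (∀ s, IsAlgebraic ℚ (P.coeff s)) ∧ N.domain = {x | ∀ i, x i ∈ Set.Ioo (0:ℝ) 1} ∧
          EqOn N.integrand (fun x => MvPolynomial.eval x P / (1 - x 0 * x 1)) N.domain ∧ y = of N} ∪
       {y : FormalRep | ∃ (r : ℝ) (Z : IntegralRep 0), IsAlgebraic ℚ r ∧ Z.domain = Set.univ ∧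
          (Z.integrand = fun _ => r) ∧ y = of Z})) :
    ∃ β q : ℝ, IsAlgebraic ℚ β ∧ IsAlgebraic ℚ q ∧ ∀ (B : IntegralRep 2) (Z : IntegralRep 0),
      B.domain = {x | ∀ i, x i ∈ Set.Ioo (0:ℝ) 1} →
      EqOn B.integrand (fun x => β / (1 - x 0 * x 1)) B.domain →
      Z.domain = Set.univ → (Z.integrand = fun _ => q) → x - of B - of Z ∈ relations := by
  obtain ⟨-, -, -, hBadd, hptadd, hexB⟩ := alg_rigid_kit
  obtain ⟨Zf, hZf⟩ := exists_ptCarrierA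
  induction hx using AddSubgroup.closure_induction with
  | mem y hy =>
    rcases hy with hy | hy
    · obtain ⟨P, N, hP, hNd, hNi, rfl⟩ := hy
      exact alg_levelOne_normalForm P hP N hNd hNi
    · obtain ⟨r, Z₀, hr, hZ₀d, hZ₀i, rfl⟩ := hy
      refine ⟨0, r, isAlgebraic_zero, hr, fun B Z hBd hBi hZd hZi => ?_⟩
      have hB := zetaBoxA_zero_mem_relations B hBi
      have hZ := pt_congr_mem_relations Z₀ Z hZ₀d hZd hZ₀i hZi
      have e : of Z₀ - of B - of Z = (of Z₀ - of Z) - of B := by abel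
      rw [e]
      exact relations.sub_mem hZ hB
  | zero =>
    refine ⟨0, 0, isAlgebraic_zero, isAlgebraic_zero, fun B Z hBd hBi hZd hZi => ?_⟩
    have hB := zetaBoxA_zero_mem_relations B hBi
    have hZ := pt_zero_mem_relations Z hZi
    have e : (0 : FormalRep) - of B - of Z = -(of B) - of Z := by abel
    rw [e]
    exact relations.sub_mem (relations.neg_mem hB) hZ
  | add y z _ _ ihy ihz =>
    obtain ⟨β₁, q₁, hβ₁, hq₁, h₁⟩ := ihy
    obtain ⟨β₂, q₂, hβ₂, hq₂, h₂⟩ := ihz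
    refine ⟨β₁ + β₂, q₁ + q₂, isAlgebraic_add' hβ₁ hβ₂, isAlgebraic_add' hq₁ hq₂,
      fun B Z hBd hBi hZd hZi => ?_⟩
    obtain ⟨B₁, hB₁d, hB₁i⟩ := hexB β₁ hβ₁
    obtain ⟨B₂, hB₂d, hB₂i⟩ := hexB β₂ hβ₂
    have e₁ := h₁ B₁ (Zf q₁) hB₁d (hB₁i ▸ fun _ _ => rfl) (hZf q₁ hq₁).1 (hZf q₁ hq₁).2
    have e₂ := h₂ B₂ (Zf q₂) hB₂d (hB₂i ▸ fun _ _ => rfl) (hZf q₂ hq₂).1 (hZf q₂ hq₂).2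
    have eB := hBadd β₁ β₂ B B₁ B₂ hBd hBi hB₁d (hB₁i ▸ fun _ _ => rfl) hB₂d (hB₂i ▸ fun _ _ => rfl)
    have eZ := hptadd q₁ q₂ Z (Zf q₁) (Zf q₂) hZd hZi (hZf q₁ hq₁).1 (hZf q₁ hq₁).2 (hZf q₂ hq₂).1
      (hZf q₂ hq₂).2
    have e : y + z - of B - of Z = (y - of B₁ - of (Zf q₁)) + (z - of B₂ - of (Zf q₂))
        - (of B - of B₁ - of B₂) - (of Z - of (Zf q₁) - of (Zf q₂)) := by abel
    rw [e]
    exact relations.sub_mem (relations.sub_mem (relations.add_mem e₁ e₂) eB) eZ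
  | neg y _ ihy =>
    obtain ⟨β, q, hβ, hq, h⟩ := ihy
    refine ⟨-β, -q, isAlgebraic_neg' hβ, isAlgebraic_neg' hq, fun B Z hBd hBi hZd hZi => ?_⟩
    obtain ⟨B₁, hB₁d, hB₁i⟩ := hexB β hβ
    obtain ⟨B₀, hB₀d, hB₀i⟩ := hexB 0 isAlgebraic_zero
    have e₁ := h B₁ (Zf q) hB₁d (hB₁i ▸ fun _ _ => rfl) (hZf q hq).1 (hZf q hq).2
    have eB := hBadd β (-β) B₀ B₁ B hB₀d (fun x hx => by rw [hB₀i]; simp) hB₁d (hB₁i ▸ fun _ _ => rfl)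
      hBd hBi
    have eB0 := zetaBoxA_zero_mem_relations B₀ (hB₀i ▸ fun _ _ => rfl)
    have eZ := hptadd q (-q) (Zf 0) (Zf q) Z (hZf 0 isAlgebraic_zero).1
      (by rw [(hZf 0 isAlgebraic_zero).2]; funext; simp) (hZf q hq).1 (hZf q hq).2 hZd hZi
    have eZ0 := pt_zero_mem_relations (Zf 0) (hZf 0 isAlgebraic_zero).2
    have e : -y - of B - of Z = -(y - of B₁ - of (Zf q)) + (of B₀ - of B₁ - of B) - of B₀
        + (of (Zf 0) - of (Zf q) - of Z) - of (Zf 0) := by abel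
    rw [e]
    exact relations.sub_mem (relations.add_mem (relations.sub_mem (relations.add_mem
      (relations.neg_mem e₁) eB) eB0) eZ) eZ0

/-- **Conjecture 1 of Kontsevich–Zagier, kernel form, for LEVEL ONE WITH REAL-ALGEBRAIC COEFFICIENTS**
— unconditionally: a formal `ℤ`-combination of box representations `[(0,1)², P/(1 − xy)]` with
`P ∈ (ℚ̄ ∩ ℝ)[x,y]` and of algebraic points `[pt, r]` with value `0` is a relation. Its normal form
`[(0,1)², β/(1−xy)] + [pt, q]` has value `βπ²/6 + q = 0` with `β, q` algebraic, so `β = q = 0` by the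
transcendence of `π` (Lindemann, `transcendental_pi_holds`). The route's "ℚ̄-coefficient enlargement" of
seat c7's level-one layer. [cite: KontsevichZagier2001, §1.2 Conjecture 1] -/
theorem alg_mem_relations_of_eval_eq_zero_of_mem_closure {x : FormalRep}
    (hx : x ∈ AddSubgroup.closure
      ({y : FormalRep | ∃ (P : MvPolynomial (Fin 2) ℝ) (N : IntegralRep 2),
          (∀ s, IsAlgebraic ℚ (P.coeff s)) ∧ N.domain = {x | ∀ i, x i ∈ Set.Ioo (0:ℝ) 1} ∧
          EqOn N.integrand (fun x => MvPolynomial.eval x P / (1 - x 0 * x 1)) N.domain ∧ y = of N} ∪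
       {y : FormalRep | ∃ (r : ℝ) (Z : IntegralRep 0), IsAlgebraic ℚ r ∧ Z.domain = Set.univ ∧
          (Z.integrand = fun _ => r) ∧ y = of Z}))
    (hv : eval x = 0) : x ∈ relations := by
  obtain ⟨hrigid, hvalB, hvalZ, -, -, hexB⟩ := alg_rigid_kit
  obtain ⟨Zf, hZf⟩ := exists_ptCarrierA
  obtain ⟨β, q, hβ, hq, h⟩ := exists_normalForm_of_mem_algClosure hx
  obtain ⟨B, hBd, hBi⟩ := hexB β hβ
  have e₁ := h B (Zf q) hBd (hBi ▸ fun _ _ => rfl) (hZf q hq).1 (hZf q hq).2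
  have h0 := relations_le_ker_eval_holds e₁
  rw [AddMonoidHom.mem_ker, map_sub, map_sub, hv, eval_of, eval_of, hvalB β B hBd (hBi ▸ fun _ _ => rfl),
    hvalZ q (Zf q) (hZf q hq).1 (hZf q hq).2] at h0
  obtain ⟨rfl, rfl⟩ := hrigid β q 0 0 hβ hq isAlgebraic_zero isAlgebraic_zero (by linarith)
  have eB := zetaBoxA_zero_mem_relations B (hBi ▸ fun _ _ => rfl)
  have eZ := pt_zero_mem_relations (Zf 0) (hZf 0 isAlgebraic_zero).2
  have e : x = (x - of B - of (Zf 0)) + of B + of (Zf 0) := by abel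
  rw [e]
  exact relations.add_mem (relations.add_mem e₁ eB) eZ

/-- **Conjecture 1 for level one with real-algebraic coefficients, two-representation form**: two
representations on `(0,1)²` with integrands `P/(1−xy)`, `P'/(1−xy)`, `P, P' ∈ (ℚ̄ ∩ ℝ)[x,y]`, and equal
values are KZ-equivalent (e.g. `√2·∫∫ dxdy/(1−xy)` against `∫∫ (√2 + x − 3√3 x²y²)/(1−xy) − …`).
[cite: KontsevichZagier2001, §1.2 Conjecture 1] -/
theorem alg_levelOne_equivalent_of_value_eq (N N' : IntegralRep 2) (P P' : MvPolynomial (Fin 2) ℝ)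
    (hP : ∀ s, IsAlgebraic ℚ (P.coeff s)) (hP' : ∀ s, IsAlgebraic ℚ (P'.coeff s))
    (hNd : N.domain = {x | ∀ i, x i ∈ Set.Ioo (0:ℝ) 1})
    (hNi : EqOn N.integrand (fun x => MvPolynomial.eval x P / (1 - x 0 * x 1)) N.domain)
    (hN'd : N'.domain = {x | ∀ i, x i ∈ Set.Ioo (0:ℝ) 1})
    (hN'i : EqOn N'.integrand (fun x => MvPolynomial.eval x P' / (1 - x 0 * x 1)) N'.domain)
    (hv : N.value = N'.value) : Equivalent N N' := by
  refine alg_mem_relations_of_eval_eq_zero_of_mem_closure (AddSubgroup.sub_mem _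
    (AddSubgroup.subset_closure (Or.inl ⟨P, N, hP, hNd, hNi, rfl⟩))
    (AddSubgroup.subset_closure (Or.inl ⟨P', N', hP', hN'd, hN'i, rfl⟩))) ?_
  rw [map_sub, eval_of, eval_of, hv, sub_self]

/-- **An algebraic level-one box against an algebraic point**: equal values imply KZ-equivalence; with
the transcendence of `π` this says the box part of the normal form vanishes.
[cite: KontsevichZagier2001, §1.2 Conjecture 1] -/
theorem alg_levelOne_equivalent_pt_of_value_eq (N : IntegralRep 2) (Z : IntegralRep 0)
    (P : MvPolynomial (Fin 2) ℝ) (hP : ∀ s, IsAlgebraic ℚ (P.coeff s)) (r : ℝ) (hr : IsAlgebraic ℚ r)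
    (hNd : N.domain = {x | ∀ i, x i ∈ Set.Ioo (0:ℝ) 1})
    (hNi : EqOn N.integrand (fun x => MvPolynomial.eval x P / (1 - x 0 * x 1)) N.domain)
    (hZd : Z.domain = Set.univ) (hZi : Z.integrand = fun _ => r)
    (hv : N.value = Z.value) : Equivalent N Z := by
  refine alg_mem_relations_of_eval_eq_zero_of_mem_closure (AddSubgroup.sub_mem _
    (AddSubgroup.subset_closure (Or.inl ⟨P, N, hP, hNd, hNi, rfl⟩))
    (AddSubgroup.subset_closure (Or.inr ⟨r, Z, hr, hZd, hZi, rfl⟩))) ?_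
  rw [map_sub, eval_of, eval_of, hv, sub_self]

end Summit.KontsevichZagierPeriods.HurwitzMicroSectors.NormalFormPrinciple.PiBox.AlgLevelOne
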